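/-
Copyright (c) 2026. All rights reserved.
Released under Apache 2.0 license as described in the file LICENSE.
Authors: abc-iut cell, wave-5 seat abc-iut-w5-d141 (L3 sub-DAG [SemiAnbd] Thm 5.4, umbrella junction v4 at the produced data).
-/
import Literature.AnabelianGeometry.SemiGraphs.ArithThm54iiiUmbrellaCompat
import Literature.AnabelianGeometry.SemiGraphs.ArithThm37iiiShadowOfChart
import HarnessLib

/-!
# [SemiAnbd] Theorem 5.4 (iii), COMPATIBLE reading, AT THE PRODUCED DECOMPOSITION DATA (junction v4; proof-only)

Mochizuki, *Semi-graphs of anabelioids*, Publ. RIMS **42** (2006), §5, Theorem 5.4 (iii) p. 66, with the data of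
p. 65 [cite: MochizukiSemiAnbd2006, Thm 5.4 (iii), p. 66].

PROOF-ONLY (no definition, nothing asserted).  The umbrella v3c
`arithQuasiGeometricCorrespondenceStatementCompat_of_iota'` (`ArithThm54iiiUmbrellaCompat.lean`, this seat) concludes
abc-iut-w4-d083's `ArithQuasiGeometricCorrespondenceStatementCompat 𝔊 ℍ e augG augH btemp` over ABSTRACT decomposition
data `D`, `D'`.  This file SPECIALISES it to the produced data of abc-iut-w4-d053 (`decompositionDataOfChart R𝒢 ι𝒢`,
`decompositionDataOfChart Rℋ ιℋ`: `Π^temp_{𝔊,v} := C(ι Π^temp_{𝔾,v})`, p. 65) over the tempered charts `c𝒢`, `cℋ` of the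
geometric components and DISCHARGES, by name, every binder that is a chart-level theorem there:
`hadj`, `hEgeom` (`ArithThm37iiiShadowOfChart.lean`: Thm 3.7 (iii) at `𝒢` + the `ArithChartAction`), `hslim` (ibid.:
verticially slim + Thm 3.7 (i)), `hcommV` / `hcommV'` (abc-iut-w4-d040's `decompositionDataOfChart_vertGp_inf_ker`,
Thm 3.7 (ii)), and `hV` (`Cor39Hypotheses.hasVertex`).  REMAINING binders (all producer data T54-B or print hypotheses,
HOME/plan/L3/SUBDAG-SemiAnbd-Thm54.md): Thm 5.4 (ii) ×2 and Rmk 5.3.1 ×2 at the produced data (`hIIG hIIH hRG hRH`,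
abc-iut-w4-d040 and abc-iut-w4-d085 umbrellas over `ArithLevelData`/`ArithChartBranchAction`), the arithmetic `B^temp` (`btemp`,
`haugH hcont hover`), the datum `ι g` with its Prop 5.2 (iv) dictionary (`hιG hιH hιinj hιbtemp hιgeomV hιgeomE hιgeomC`
— the last three from abc-iut-w4-d083's `iotaShadows_of_compatVAt` once `ι g` is read through the charts), the compatible
geometric Cor 3.9 (b) at the kernels `hCor39c` (antecedents ⇒ chart conclusion: abc-iut-w4-d083's
`exists_hom_chartPullbackWith_iso_of_kernelShadows`; the last line is the `ι g` vocabulary bridge), the branch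
commensurators `hcommB hcommB'` (`ArithChartBranchAction.hcommB_At` modulo no branch switching), `hsurjG`, continuity
of `e`.  Nothing here bears on [IUTchIII] Cor. 3.12; typed ≠ proved for the inputs.
-/

namespace Literature.AnabelianGeometry.SemiGraphs

open _root_.CategoryTheory ProfiniteSemiGraph

universe u v w u₀ uG uH

variable {Obj : Type u} [Category.{v} Obj] {𝓥 : SemiAnbdVocab.{u, v, w} Obj}
variable {𝔊 ℍ : ArithSemiGraph 𝓥} {e : 𝔊.PA ≃* ℍ.PA}
variable {𝒢 ℋ : ProfiniteSemiGraph.{u₀}} {c𝒢 : TemperedPiChart 𝒢} {cℋ : TemperedPiChart ℋ}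
variable {Gtp : Type uG} [Group Gtp] [TopologicalSpace Gtp]
variable {Htp : Type uH} [Group Htp] [TopologicalSpace Htp] [IsTopologicalGroup Htp] [T2Space Htp]

/-- **[SemiAnbd] Theorem 5.4 (iii), COMPATIBLE reading, at the PRODUCED decomposition data** (junction v4): the
umbrella v3c `arithQuasiGeometricCorrespondenceStatementCompat_of_iota'` with `D := decompositionDataOfChart R𝒢 ι𝒢`,
`D' := decompositionDataOfChart Rℋ ιℋ` and the chart-level binders `hadj`, `hEgeom`, `hslim`, `hcommV`, `hcommV'`, `hV`
DISCHARGED from Thm 3.7 (iii) at `𝒢` (`CompactInVerticialAt`), the Cor 3.9 frame at `𝒢`, the Thm 3.7 frame at `ℋ`,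
injectivity of `ι𝒢`, `ιℋ` with `range = Ker` (Prop 5.2 (iv)), continuity of `ιℋ`, and the two `ArithChartAction`s
(Def 5.1 (i) via Prop 3.6 (iv)).  Remaining binders: see the module docstring.
[cite: MochizukiSemiAnbd2006, Thm 5.4 (iii), p. 66] -/
theorem arithQuasiGeometricCorrespondenceStatementCompat_ofChart (augG : Gtp →* 𝔊.PA) (augH : Htp →* ℍ.PA)
    (btemp : (φ : ArithHom 𝓥 𝔊 ℍ) → φ.IsLocallyOpen → ArithHom.IsOverA 𝔊 ℍ e φ → (Gtp →* Htp))
    -- the geometric charts and the produced decomposition data (T54-0 / T54-B producer currency)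
    (h𝒢iii : CompactInVerticialAt 𝒢) (h𝒢 : Cor39Hypotheses 𝒢) (hℋ : ℋ.Thm37Hypotheses)
    (R𝒢 : ChartRepresentatives c𝒢) (Rℋ : ChartRepresentatives cℋ)
    (ι𝒢 : c𝒢.G →* Gtp) (hι𝒢 : Function.Injective ι𝒢) (ιℋ : cℋ.G →* Htp) (hιℋ : Function.Injective ιℋ)
    (hιℋc : Continuous ιℋ) (hex𝒢 : ι𝒢.range = augG.ker)
    (hexℋ : ιℋ.range = (e.symm.toMonoidHom.comp augH).ker)
    {actV : 𝔊.PA → 𝒢.graph.Vertex → 𝒢.graph.Vertex} {actE : 𝔊.PA → 𝒢.graph.Edge → 𝒢.graph.Edge}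
    {actB : 𝔊.PA → 𝒢.graph.Branch → 𝒢.graph.Branch} (A𝒢 : ArithChartAction c𝒢 ι𝒢 augG actV actE actB)
    {actV' : 𝔊.PA → ℋ.graph.Vertex → ℋ.graph.Vertex} {actE' : 𝔊.PA → ℋ.graph.Edge → ℋ.graph.Edge}
    {actB' : 𝔊.PA → ℋ.graph.Branch → ℋ.graph.Branch}
    (Aℋ : ArithChartAction cℋ ιℋ (e.symm.toMonoidHom.comp augH) actV' actE' actB')
    -- the remaining binders of v3c, verbatim at the produced data
    (hIIG : ArithMaximalCompactStatementII (decompositionDataOfChart R𝒢 ι𝒢) augG)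
    (hIIH : ArithMaximalCompactStatementII (decompositionDataOfChart Rℋ ιℋ) (e.symm.toMonoidHom.comp augH))
    (hRG : VerticialEdgeLikeCompactAmpleStatement (decompositionDataOfChart R𝒢 ι𝒢) augG)
    (hRH : VerticialEdgeLikeCompactAmpleStatement (decompositionDataOfChart Rℋ ιℋ) (e.symm.toMonoidHom.comp augH))
    (haugH : Continuous (e.symm.toMonoidHom.comp augH))
    (hcont : ∀ (φ : ArithHom 𝓥 𝔊 ℍ) (h₁ : φ.IsLocallyOpen) (h₂ : ArithHom.IsOverA 𝔊 ℍ e φ),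
      Continuous (btemp φ h₁ h₂))
    (hover : ∀ (φ : ArithHom 𝓥 𝔊 ℍ) (h₁ : φ.IsLocallyOpen) (h₂ : ArithHom.IsOverA 𝔊 ℍ e φ),
      (e.symm.toMonoidHom.comp augH).comp (btemp φ h₁ h₂) = augG)
    (ι : (𝔊.G ⟶ ℍ.G) → (augG.ker →* Htp))
    (hιG : ∀ (g : 𝔊.G ⟶ ℍ.G) (a : 𝔊.PA) (γ : Gtp), augG γ = a →
      ∃ δ ∈ (e.symm.toMonoidHom.comp augH).ker, ∀ x : augG.ker, ι ((𝔊.ρ a).hom ≫ g) x =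
        δ * ι g ⟨γ * x * γ⁻¹, (MonoidHom.normal_ker augG).conj_mem _ x.2 γ⟩ * δ⁻¹)
    (hιH : ∀ (g : 𝔊.G ⟶ ℍ.G) (a : 𝔊.PA) (η : Htp), (e.symm.toMonoidHom.comp augH) η = a →
      ∃ δ ∈ (e.symm.toMonoidHom.comp augH).ker,
        ∀ x : augG.ker, ι (g ≫ (ℍ.ρ (e a)).hom) x = δ * (η * ι g x * η⁻¹) * δ⁻¹)
    (hιinj : ∀ g₁ g₂ : 𝔊.G ⟶ ℍ.G,
      (∃ δ ∈ (e.symm.toMonoidHom.comp augH).ker, ∀ x : augG.ker, ι g₁ x = δ * ι g₂ x * δ⁻¹) →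
        g₁ = g₂)
    (hιbtemp : ∀ (φ : ArithHom 𝓥 𝔊 ℍ) (h₁ : φ.IsLocallyOpen) (h₂ : ArithHom.IsOverA 𝔊 ℍ e φ),
      ∃ δ ∈ (e.symm.toMonoidHom.comp augH).ker,
        ∀ x : augG.ker, btemp φ h₁ h₂ x = δ * ι φ.geom x * δ⁻¹)
    (hιgeomV : ∀ g : 𝔊.G ⟶ ℍ.G, ∃ fv : 𝒢.graph.Vertex → ℋ.graph.Vertex, ∀ v : 𝒢.graph.Vertex, ∃ x : Htp,
      (((decompositionDataOfChart R𝒢 ι𝒢).vertGp v ⊓ augG.ker).subgroupOf augG.ker).map (ι g) ≤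
          conjSubgroup x ((decompositionDataOfChart Rℋ ιℋ).vertGp (fv v)) ⊓ (e.symm.toMonoidHom.comp augH).ker ∧
        IsOpen ((Subtype.val :
            (conjSubgroup x ((decompositionDataOfChart Rℋ ιℋ).vertGp (fv v)) ⊓ (e.symm.toMonoidHom.comp augH).ker : Subgroup Htp) → Htp) ⁻¹'
          ((((decompositionDataOfChart R𝒢 ι𝒢).vertGp v ⊓ augG.ker).subgroupOf augG.ker).map (ι g) : Set Htp)))
    (hιgeomE : ∀ g : 𝔊.G ⟶ ℍ.G, ∃ fb : 𝒢.graph.Branch → ℋ.graph.Branch, ∀ b : 𝒢.graph.Branch, ∃ x : Htp,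
      (((decompositionDataOfChart R𝒢 ι𝒢).brGp b ⊓ augG.ker).subgroupOf augG.ker).map (ι g) ≤
          conjSubgroup x ((decompositionDataOfChart Rℋ ιℋ).brGp (fb b)) ⊓ (e.symm.toMonoidHom.comp augH).ker ∧
        IsOpen ((Subtype.val :
            (conjSubgroup x ((decompositionDataOfChart Rℋ ιℋ).brGp (fb b)) ⊓ (e.symm.toMonoidHom.comp augH).ker : Subgroup Htp) → Htp) ⁻¹'
          ((((decompositionDataOfChart R𝒢 ι𝒢).brGp b ⊓ augG.ker).subgroupOf augG.ker).map (ι g) : Set Htp)))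
    (hιgeomC : ∀ (φ : ArithHom 𝓥 𝔊 ℍ), φ.IsLocallyOpen → ∀ (v₁ v₂ : 𝒢.graph.Vertex) (γ₁ γ₂ : Gtp),
      conjSubgroup γ₁ ((decompositionDataOfChart R𝒢 ι𝒢).vertGp v₁) ⊓ augG.ker ≠ conjSubgroup γ₂ ((decompositionDataOfChart R𝒢 ι𝒢).vertGp v₂) ⊓ augG.ker →
      conjSubgroup γ₁ ((decompositionDataOfChart R𝒢 ι𝒢).vertGp v₁) ⊓ conjSubgroup γ₂ ((decompositionDataOfChart R𝒢 ι𝒢).vertGp v₂) ⊓ augG.ker ≠ ⊥ →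
        ∃ (w₁ w₂ : ℋ.graph.Vertex) (x₁ x₂ : Htp),
          conjSubgroup x₁ ((decompositionDataOfChart Rℋ ιℋ).vertGp w₁) ⊓ (e.symm.toMonoidHom.comp augH).ker ≠
              conjSubgroup x₂ ((decompositionDataOfChart Rℋ ιℋ).vertGp w₂) ⊓ (e.symm.toMonoidHom.comp augH).ker ∧
            MapsOntoOpenSubgroupOf (ι φ.geom) ((conjSubgroup γ₁ ((decompositionDataOfChart R𝒢 ι𝒢).vertGp v₁) ⊓ augG.ker).subgroupOf augG.ker)
              (conjSubgroup x₁ ((decompositionDataOfChart Rℋ ιℋ).vertGp w₁) ⊓ (e.symm.toMonoidHom.comp augH).ker) ∧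
            MapsOntoOpenSubgroupOf (ι φ.geom) ((conjSubgroup γ₂ ((decompositionDataOfChart R𝒢 ι𝒢).vertGp v₂) ⊓ augG.ker).subgroupOf augG.ker)
              (conjSubgroup x₂ ((decompositionDataOfChart Rℋ ιℋ).vertGp w₂) ⊓ (e.symm.toMonoidHom.comp augH).ker))
    (hCor39c : ∀ f : Gtp →* Htp, Continuous f → (e.symm.toMonoidHom.comp augH).comp f = augG →
      (∀ v : 𝒢.graph.Vertex, ∃ (w : ℋ.graph.Vertex) (x : Htp), MapsOntoOpenSubgroupOf f ((decompositionDataOfChart R𝒢 ι𝒢).vertGp v ⊓ augG.ker)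
        (conjSubgroup x ((decompositionDataOfChart Rℋ ιℋ).vertGp w) ⊓ (e.symm.toMonoidHom.comp augH).ker)) →
      (∀ b : 𝒢.graph.Branch, ∃ (b' : ℋ.graph.Branch) (x : Htp), MapsOntoOpenSubgroupOf f ((decompositionDataOfChart R𝒢 ι𝒢).brGp b ⊓ augG.ker)
        (conjSubgroup x ((decompositionDataOfChart Rℋ ιℋ).brGp b') ⊓ (e.symm.toMonoidHom.comp augH).ker)) →
      (∀ (v₁ v₂ : 𝒢.graph.Vertex) (γ₁ γ₂ : Gtp),
        conjSubgroup γ₁ ((decompositionDataOfChart R𝒢 ι𝒢).vertGp v₁) ⊓ augG.ker ≠ conjSubgroup γ₂ ((decompositionDataOfChart R𝒢 ι𝒢).vertGp v₂) ⊓ augG.ker →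
        conjSubgroup γ₁ ((decompositionDataOfChart R𝒢 ι𝒢).vertGp v₁) ⊓ conjSubgroup γ₂ ((decompositionDataOfChart R𝒢 ι𝒢).vertGp v₂) ⊓ augG.ker ≠ ⊥ →
          ∃ (w₁ w₂ : ℋ.graph.Vertex) (x₁ x₂ : Htp),
            conjSubgroup x₁ ((decompositionDataOfChart Rℋ ιℋ).vertGp w₁) ⊓ (e.symm.toMonoidHom.comp augH).ker ≠
                conjSubgroup x₂ ((decompositionDataOfChart Rℋ ιℋ).vertGp w₂) ⊓ (e.symm.toMonoidHom.comp augH).ker ∧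
              (conjSubgroup γ₁ ((decompositionDataOfChart R𝒢 ι𝒢).vertGp v₁) ⊓ augG.ker).map f ≤ conjSubgroup x₁ ((decompositionDataOfChart Rℋ ιℋ).vertGp w₁) ∧
                (conjSubgroup γ₂ ((decompositionDataOfChart R𝒢 ι𝒢).vertGp v₂) ⊓ augG.ker).map f ≤ conjSubgroup x₂ ((decompositionDataOfChart Rℋ ιℋ).vertGp w₂)) →
      ∃ (g : 𝔊.G ⟶ ℍ.G), ∃ h ∈ (e.symm.toMonoidHom.comp augH).ker,
        ∀ x : augG.ker, f x = h * ι g x * h⁻¹)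
    (hcommB : ∀ b : 𝒢.graph.Branch, Subgroup.Commensurable.commensurator ((decompositionDataOfChart R𝒢 ι𝒢).brGp b ⊓ augG.ker) = (decompositionDataOfChart R𝒢 ι𝒢).brGp b)
    (hcommB' : ∀ b' : ℋ.graph.Branch, Subgroup.Commensurable.commensurator
      ((decompositionDataOfChart Rℋ ιℋ).brGp b' ⊓ (e.symm.toMonoidHom.comp augH).ker) = (decompositionDataOfChart Rℋ ιℋ).brGp b')
    (hsurjG : Function.Surjective augG) (he : Continuous e) :
    Literature.AnabelianGeometry.SemiGraphs.ArithQuasiGeometricCorrespondenceStatementCompat 𝔊 ℍ e augG augH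
      btemp :=
  arithQuasiGeometricCorrespondenceStatementCompat_of_iota' augG augH btemp hIIG hIIH hRG hRH haugH hcont hover
    (ProfiniteSemiGraph.hEgeom_decompositionDataOfChart h𝒢iii h𝒢 R𝒢 ι𝒢 hι𝒢 augG hex𝒢 A𝒢)
    ι hιG hιH hιinj hιbtemp hιgeomV hιgeomE hιgeomC hCor39c
    (ProfiniteSemiGraph.hadj_decompositionDataOfChart h𝒢iii h𝒢 R𝒢 ι𝒢 hι𝒢 augG hex𝒢 A𝒢)
    (fun v => (ProfiniteSemiGraph.decompositionDataOfChart_vertGp_inf_ker h𝒢.thm37Hypotheses R𝒢 ι𝒢 hι𝒢 augG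
      hex𝒢 v).2)
    (fun w => (ProfiniteSemiGraph.decompositionDataOfChart_vertGp_inf_ker hℋ Rℋ ιℋ hιℋ
      (e.symm.toMonoidHom.comp augH) hexℋ w).2)
    hcommB hcommB'
    (ProfiniteSemiGraph.hslim_decompositionDataOfChart hℋ Rℋ ιℋ hιℋ hιℋc (e.symm.toMonoidHom.comp augH) hexℋ Aℋ)
    hsurjG he h𝒢.hasVertex

end Literature.AnabelianGeometry.SemiGraphs
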